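import Mathlib
import Literature.Analysis.FluidPDE.GaussianVortexPlanar
import Literature.Analysis.FluidPDE.GaussianVortexPlanarProofs
import Literature.Analysis.FluidPDE.BiotSavart2DSymmetry
import Summits.AnomalousDissipation.AnomalousDissipation.Theorems.MarginalStabilityChainStretchedVortexRowsStubLogPotentialTools
import Summits.AnomalousDissipation.AnomalousDissipation.Theorems.MarginalStabilityChainStretchedVortexRowsStubLogPotentialGradient
import Summits.AnomalousDissipation.AnomalousDissipation.Theorems.MarginalStabilityChainStretchedVortexRowsStubLogPotentialGreen
import Summits.AnomalousDissipation.AnomalousDissipation.Theorems.MarginalStabilityChainStretchedVortexRowsStubLogPotentialDecay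
import HarnessLib

/-!
# Helper `logPotential_energy_identity` toward stub `stub_coreInverse` of the line
# `braid-closed-large-circulation-gluing` (crux stmt-AnomalousDissipation-3009, `MarginalStabilityChain.StretchedVortexRows`)

The energy identity `∫ ‖∇ψ‖² = −∫ ψ g` for the logarithmic potential `ψ = N ∗ g` of a NEUTRAL `C¹` Gaussian-class
density on `ℝ² = EuclideanSpace ℝ (Fin 2)` (wave 3, toward `logPotential_neutral_energy`), from the weak Poisson
equation `∫ ⟪∇ψ, ∇φ⟫ = −∫ g φ` (helper `logPotential_weak_poisson`) tested against the cut-offs `φ_n = χ_n ψ`,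
`χ_n(ξ) = χ(ξ/(n+1))`, `χ` a fixed smooth bump equal to `1` on the unit ball and supported in the ball of radius `2`:

* `∫ χ_n ‖∇ψ‖² + ∫ ψ ⟪∇χ_n, ∇ψ⟫ = −∫ g χ_n ψ` for every `n`;
* `∫ χ_n ‖∇ψ‖² → ∫ ‖∇ψ‖²` and `∫ g χ_n ψ → ∫ g ψ` by dominated convergence (`‖∇ψ‖ ≤ C/(1+‖ξ‖)²` from the
  NEUTRALITY, helper `logPotential_gradient_decay`; `|ψ| ≤ C(1 + log(1 + ‖ξ‖))`);
* the error `∫ ψ ⟪∇χ_n, ∇ψ⟫ → 0`: `‖∇χ_n(ξ)‖ ≤ 4M/(1 + ‖ξ‖)` uniformly in `n` and `∇χ_n(ξ) = 0` eventually, so the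
  integrand is dominated by `K (1 + ‖ξ‖)^{−5/2} ∈ L¹(ℝ²)` (`1 + log(1+t) ≤ 2(1+t)^{1/2}`) and tends to `0` pointwise.
-/

set_option linter.dupNamespace false
noncomputable section
open scoped RealInnerProductSpace Topology
open MeasureTheory WithLp Function Metric Filter Set

namespace Summit.AnomalousDissipation.AnomalousDissipation.Theorems.MarginalStabilityChainStretchedVortexRows

open Literature.Analysis.FluidPDE

/-! ### Scaled cut-offs -/

/-- **Scaled cut-offs.** For `χ ∈ C¹_c` with `χ = 1` on the unit ball, `χ = 0` outside the ball of radius `2` and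
`‖Dχ‖ ≤ M`, the rescaled `χ_R = χ(·/R)` (`R ≥ 1`) is `C¹` with compact support, equals `1` on `‖ξ‖ < R`, has
`Dχ_R(ξ) = 0` for `‖ξ‖ < R`, and `‖Dχ_R(ξ)‖ ≤ 4M/(1 + ‖ξ‖)` everywhere. [folklore] -/
theorem scaledCutoff_props {χ : EuclideanSpace ℝ (Fin 2) → ℝ} (hχ : ContDiff ℝ 1 χ) (hχc : HasCompactSupport χ)
    (h1 : ∀ x, ‖x‖ ≤ 1 → χ x = 1) (h0 : ∀ x, 2 ≤ ‖x‖ → χ x = 0) {M : ℝ} (hM : ∀ x, ‖fderiv ℝ χ x‖ ≤ M)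
    {R : ℝ} (hR : 1 ≤ R) :
    ContDiff ℝ 1 (fun x : EuclideanSpace ℝ (Fin 2) => χ (R⁻¹ • x)) ∧
      HasCompactSupport (fun x : EuclideanSpace ℝ (Fin 2) => χ (R⁻¹ • x)) ∧
      (∀ x : EuclideanSpace ℝ (Fin 2), ‖x‖ < R → χ (R⁻¹ • x) = 1) ∧
      (∀ x : EuclideanSpace ℝ (Fin 2), ‖x‖ < R → fderiv ℝ (fun x : EuclideanSpace ℝ (Fin 2) => χ (R⁻¹ • x)) x = 0) ∧
      ∀ x : EuclideanSpace ℝ (Fin 2), ‖fderiv ℝ (fun x : EuclideanSpace ℝ (Fin 2) => χ (R⁻¹ • x)) x‖ ≤ 4 * M / (1 + ‖x‖) := by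
  have hR0 : 0 < R := by linarith
  have hRi : 0 < R⁻¹ := inv_pos.2 hR0
  have hM0 : 0 ≤ M := (norm_nonneg _).trans (hM 0)
  have hnorm : ∀ x : EuclideanSpace ℝ (Fin 2), ‖R⁻¹ • x‖ = R⁻¹ * ‖x‖ := fun x => by
    rw [norm_smul, Real.norm_of_nonneg hRi.le]
  have hdiff : ContDiff ℝ 1 (fun x : EuclideanSpace ℝ (Fin 2) => χ (R⁻¹ • x)) :=
    hχ.comp (contDiff_id.const_smul R⁻¹)
  have hone : ∀ x : EuclideanSpace ℝ (Fin 2), ‖x‖ < R → χ (R⁻¹ • x) = 1 := fun x hx => by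
    refine h1 _ ?_
    rw [hnorm, inv_mul_le_iff₀ hR0]
    linarith
  have hzero : ∀ x : EuclideanSpace ℝ (Fin 2), 2 * R < ‖x‖ → χ (R⁻¹ • x) = 0 := fun x hx => by
    refine h0 _ ?_
    rw [hnorm, le_inv_mul_iff₀ hR0]
    linarith
  -- the derivative
  have hderiv : ∀ x : EuclideanSpace ℝ (Fin 2), HasFDerivAt (fun x : EuclideanSpace ℝ (Fin 2) => χ (R⁻¹ • x))
      ((fderiv ℝ χ (R⁻¹ • x)).comp (R⁻¹ • ContinuousLinearMap.id ℝ (EuclideanSpace ℝ (Fin 2)))) x := fun x =>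
    ((hχ.differentiable one_ne_zero) _).hasFDerivAt.comp x ((hasFDerivAt_id x).const_smul R⁻¹)
  have hbd : ∀ x : EuclideanSpace ℝ (Fin 2), ‖fderiv ℝ (fun x : EuclideanSpace ℝ (Fin 2) => χ (R⁻¹ • x)) x‖ ≤ M * R⁻¹ := by
    intro x
    rw [(hderiv x).fderiv]
    refine (ContinuousLinearMap.opNorm_comp_le _ _).trans ?_
    rw [norm_smul, Real.norm_of_nonneg hRi.le]
    calc ‖fderiv ℝ χ (R⁻¹ • x)‖ * (R⁻¹ * ‖ContinuousLinearMap.id ℝ (EuclideanSpace ℝ (Fin 2))‖)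
        ≤ M * (R⁻¹ * 1) := by
          gcongr
          · exact hM _
          · exact ContinuousLinearMap.norm_id_le
      _ = M * R⁻¹ := by ring
  -- local constancy
  have hfd_in : ∀ x : EuclideanSpace ℝ (Fin 2), ‖x‖ < R →
      fderiv ℝ (fun x : EuclideanSpace ℝ (Fin 2) => χ (R⁻¹ • x)) x = 0 := by
    intro x hx
    have hev : (fun x : EuclideanSpace ℝ (Fin 2) => χ (R⁻¹ • x)) =ᶠ[𝓝 x] fun _ => (1:ℝ) := by
      filter_upwards [(isOpen_lt continuous_norm continuous_const).mem_nhds hx] with y hy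
      exact hone y hy
    rw [hev.fderiv_eq, fderiv_const_apply]
  have hfd_out : ∀ x : EuclideanSpace ℝ (Fin 2), 2 * R < ‖x‖ →
      fderiv ℝ (fun x : EuclideanSpace ℝ (Fin 2) => χ (R⁻¹ • x)) x = 0 := by
    intro x hx
    have hev : (fun x : EuclideanSpace ℝ (Fin 2) => χ (R⁻¹ • x)) =ᶠ[𝓝 x] fun _ => (0:ℝ) := by
      filter_upwards [(isOpen_lt continuous_const continuous_norm).mem_nhds hx] with y hy
      exact hzero y hy
    rw [hev.fderiv_eq, fderiv_const_apply]
  refine ⟨hdiff, ?_, hone, hfd_in, fun x => ?_⟩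
  · have : (fun x : EuclideanSpace ℝ (Fin 2) => χ (R⁻¹ • x)) = χ ∘ (Homeomorph.smulOfNeZero R⁻¹ hRi.ne') := rfl
    rw [this]
    exact hχc.comp_homeomorph _
  · have hpos : 0 < 1 + ‖x‖ := by positivity
    by_cases hin : ‖x‖ < R
    · rw [hfd_in x hin, norm_zero]; positivity
    by_cases hout : 2 * R < ‖x‖
    · rw [hfd_out x hout, norm_zero]; positivity
    rw [not_lt] at hin hout
    refine (hbd x).trans ?_
    rw [le_div_iff₀ hpos]
    have h2 : ‖x‖ * R⁻¹ ≤ 2 := by rw [mul_inv_le_iff₀ hR0]; linarith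
    nlinarith [mul_nonneg hM0 hRi.le]

/-- A fixed `C¹` bump on `ℝ²`: `χ = 1` on the closed unit ball, `χ = 0` outside the ball of radius `2`, with bounded
derivative. [folklore] -/
theorem exists_bump :
    ∃ (χ : EuclideanSpace ℝ (Fin 2) → ℝ) (M : ℝ), ContDiff ℝ 1 χ ∧ HasCompactSupport χ ∧
      (∀ x, ‖x‖ ≤ 1 → χ x = 1) ∧ (∀ x, 2 ≤ ‖x‖ → χ x = 0) ∧ (∀ x, 0 ≤ χ x ∧ χ x ≤ 1) ∧
      ∀ x, ‖fderiv ℝ χ x‖ ≤ M := by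
  let χ₀ : ContDiffBump (0 : EuclideanSpace ℝ (Fin 2)) := ⟨1, 2, one_pos, one_lt_two⟩
  have hc : ContDiff ℝ 1 (χ₀ : EuclideanSpace ℝ (Fin 2) → ℝ) := χ₀.contDiff
  have hs : HasCompactSupport (χ₀ : EuclideanSpace ℝ (Fin 2) → ℝ) := χ₀.hasCompactSupport
  obtain ⟨M, hM⟩ := (hc.continuous_fderiv one_ne_zero).bounded_above_of_compact_support (hs.fderiv (𝕜 := ℝ))
  refine ⟨χ₀, M, hc, hs, fun x hx => χ₀.one_of_mem_closedBall (by simpa using hx),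
    fun x hx => χ₀.zero_of_le_dist (by simpa using hx), fun x => ⟨χ₀.nonneg, χ₀.le_one⟩, hM⟩

/-! ### Two elementary estimates -/

/-- `1 + log(1 + t) ≤ 2 √(1 + t)` for `t ≥ 0`. [folklore] -/
theorem one_add_log_le_two_sqrt {t : ℝ} (ht : 0 ≤ t) : 1 + Real.log (1 + t) ≤ 2 * Real.sqrt (1 + t) := by
  have h1 : 0 < Real.sqrt (1 + t) := Real.sqrt_pos.2 (by linarith)
  have h2 : Real.log (1 + t) = 2 * Real.log (Real.sqrt (1 + t)) := by
    rw [Real.log_sqrt (by linarith)]; ring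
  have h3 := Real.log_le_sub_one_of_pos h1
  have h4 : 1 ≤ Real.sqrt (1 + t) :=
    calc (1:ℝ) = Real.sqrt 1 := Real.sqrt_one.symm
      _ ≤ Real.sqrt (1 + t) := Real.sqrt_le_sqrt (by linarith)
  linarith

/-- `(1 + log(1+‖ξ‖)) (1+‖ξ‖)⁻¹ ((1+‖ξ‖)²)⁻¹ ≤ 2 (1 + ‖ξ‖)^{−5/2}`. [folklore] -/
theorem log_weight_le_rpow (ξ : EuclideanSpace ℝ (Fin 2)) :
    (1 + Real.log (1 + ‖ξ‖)) * ((1 + ‖ξ‖)⁻¹ * ((1 + ‖ξ‖) ^ 2)⁻¹) ≤ 2 * (1 + ‖ξ‖) ^ (-(5 / 2 : ℝ)) := by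
  have ht : 0 < 1 + ‖ξ‖ := by positivity
  have h1 := one_add_log_le_two_sqrt (norm_nonneg ξ)
  have h2 : Real.sqrt (1 + ‖ξ‖) * ((1 + ‖ξ‖)⁻¹ * ((1 + ‖ξ‖) ^ 2)⁻¹) = (1 + ‖ξ‖) ^ (-(5 / 2 : ℝ)) := by
    rw [Real.sqrt_eq_rpow, ← Real.rpow_neg_one, ← Real.rpow_natCast, ← Real.rpow_neg ht.le,
      ← Real.rpow_add ht, ← Real.rpow_add ht]
    norm_num
  calc (1 + Real.log (1 + ‖ξ‖)) * ((1 + ‖ξ‖)⁻¹ * ((1 + ‖ξ‖) ^ 2)⁻¹)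
      ≤ (2 * Real.sqrt (1 + ‖ξ‖)) * ((1 + ‖ξ‖)⁻¹ * ((1 + ‖ξ‖) ^ 2)⁻¹) :=
        mul_le_mul_of_nonneg_right h1 (by positivity)
    _ = 2 * (1 + ‖ξ‖) ^ (-(5 / 2 : ℝ)) := by rw [mul_assoc, h2]

/-! ### The energy identity -/

section Energy

variable {B : ℝ} {g : EuclideanSpace ℝ (Fin 2) → ℝ} (hg : ContDiff ℝ 1 g)
  (hg0 : ∀ η, |g η| ≤ B * Real.exp (-(1 / 8) * ‖η‖ ^ 2))
  (hg1 : ∀ η, ‖fderiv ℝ g η‖ ≤ B * Real.exp (-(1 / 8) * ‖η‖ ^ 2)) (hneutral : ∫ η, g η = 0)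
  {ψ : EuclideanSpace ℝ (Fin 2) → ℝ}
  (hψ : ψ = fun ξ : EuclideanSpace ℝ (Fin 2) => ∫ η, (2 * Real.pi)⁻¹ * Real.log ‖ξ - η‖ * g η)
include hg hg0 hg1 hψ

/-- `ψ ∈ C¹` and `∇ψ` is continuous. [folklore] -/
theorem contDiff_and_continuous_gradient : ContDiff ℝ 1 ψ ∧ Continuous (gradient ψ) := by
  have hC1 : ContDiff ℝ 1 ψ := by rw [hψ]; exact (logPotential_contDiff_one B g hg hg0 hg1).1
  exact ⟨hC1, (InnerProductSpace.toDual ℝ (EuclideanSpace ℝ (Fin 2))).symm.continuous.comp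
    (hC1.continuous_fderiv one_ne_zero)⟩

include hneutral in
/-- **`‖∇ψ‖² ∈ L¹(ℝ²)`** for a neutral density (`‖∇ψ‖ ≤ C/(1+‖ξ‖)²`). [folklore] -/
theorem integrable_norm_gradient_sq : Integrable fun ξ => ‖gradient ψ ξ‖ ^ 2 := by
  obtain ⟨Cg, hCg⟩ : ∃ C : ℝ, ∀ ξ, ‖gradient ψ ξ‖ ≤ C / (1 + ‖ξ‖) ^ 2 := by
    rw [hψ]; exact logPotential_gradient_decay B g hg hg0 hg1 hneutral
  obtain ⟨-, hgradc⟩ := contDiff_and_continuous_gradient hg hg0 hg1 hψ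
  have hJ : Integrable fun x : EuclideanSpace ℝ (Fin 2) => (1 + ‖x‖) ^ (-(4:ℝ)) :=
    integrable_one_add_norm (by rw [finrank_euclideanSpace_fin]; norm_num)
  refine (hJ.const_mul (Cg ^ 2)).mono' (hgradc.norm.pow 2).aestronglyMeasurable (Eventually.of_forall fun ξ => ?_)
  rw [Real.norm_of_nonneg (sq_nonneg _)]
  have hpos : 0 < 1 + ‖ξ‖ := by positivity
  have h4 : (1 + ‖ξ‖) ^ (-(4:ℝ)) = ((1 + ‖ξ‖) ^ 4)⁻¹ := by
    rw [Real.rpow_neg hpos.le, ← Real.rpow_natCast]; norm_num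
  rw [h4]
  calc ‖gradient ψ ξ‖ ^ 2 ≤ (Cg / (1 + ‖ξ‖) ^ 2) ^ 2 := pow_le_pow_left₀ (norm_nonneg _) (hCg ξ) 2
    _ = Cg ^ 2 * ((1 + ‖ξ‖) ^ 4)⁻¹ := by field_simp

/-- **`ψ g ∈ L¹(ℝ²)`** (`|ψ| ≤ C(1 + log(1+‖ξ‖)) ≤ C(1+‖ξ‖)`, `|g| ≤ B e^{−‖ξ‖²/8}`). [folklore] -/
theorem integrable_logPotential_mul : Integrable fun ξ => ψ ξ * g ξ := by
  obtain ⟨Cψ, hCψ0, hCψ⟩ : ∃ C : ℝ, 0 ≤ C ∧ ∀ ξ, |ψ ξ| ≤ C * (1 + Real.log (1 + ‖ξ‖)) := by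
    rw [hψ]; exact abs_logPotential_le hg0
  obtain ⟨hC1, -⟩ := contDiff_and_continuous_gradient hg hg0 hg1 hψ
  refine ((integrable_one_add_norm_pow_mul_exp_eighth 1).const_mul (Cψ * B)).mono'
    (hC1.continuous.mul hg.continuous).aestronglyMeasurable (Eventually.of_forall fun ξ => ?_)
  rw [Real.norm_eq_abs, abs_mul]
  have hlog : Real.log (1 + ‖ξ‖) ≤ ‖ξ‖ := by
    have := Real.log_le_sub_one_of_pos (by positivity : (0:ℝ) < 1 + ‖ξ‖); linarith
  have hL : 0 ≤ Real.log (1 + ‖ξ‖) := Real.log_nonneg (by linarith [norm_nonneg ξ])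
  calc |ψ ξ| * |g ξ| ≤ Cψ * (1 + Real.log (1 + ‖ξ‖)) * (B * Real.exp (-(1 / 8) * ‖ξ‖ ^ 2)) :=
        mul_le_mul (hCψ ξ) (hg0 ξ) (abs_nonneg _) (by positivity)
    _ ≤ Cψ * (1 + ‖ξ‖) ^ 1 * (B * Real.exp (-(1 / 8) * ‖ξ‖ ^ 2)) := by
        gcongr
        · exact (abs_nonneg _).trans (hg0 ξ)
        · rw [pow_one]; linarith
    _ = Cψ * B * ((1 + ‖ξ‖) ^ 1 * Real.exp (-(1 / 8) * ‖ξ‖ ^ 2)) := by ring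

include hneutral in
/-- **The energy identity `∫ ‖∇ψ‖² = −∫ ψ g`** for a neutral `C¹` Gaussian-class density (cut-off argument on the weak
Poisson equation). [folklore] -/
theorem integral_norm_gradient_sq_eq : ∫ ξ, ‖gradient ψ ξ‖ ^ 2 = -∫ ξ, ψ ξ * g ξ := by
  obtain ⟨hC1, hgradc⟩ := contDiff_and_continuous_gradient hg hg0 hg1 hψ
  have hψd : Differentiable ℝ ψ := hC1.differentiable one_ne_zero
  obtain ⟨Cψ, hCψ0, hCψ⟩ : ∃ C : ℝ, 0 ≤ C ∧ ∀ ξ, |ψ ξ| ≤ C * (1 + Real.log (1 + ‖ξ‖)) := by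
    rw [hψ]; exact abs_logPotential_le hg0
  obtain ⟨Cg, hCg⟩ : ∃ C : ℝ, ∀ ξ, ‖gradient ψ ξ‖ ≤ C / (1 + ‖ξ‖) ^ 2 := by
    rw [hψ]; exact logPotential_gradient_decay B g hg hg0 hg1 hneutral
  have hCg0 : 0 ≤ Cg := by
    have h := (norm_nonneg _).trans (hCg 0)
    simpa using h
  have hweak : ∀ φ : EuclideanSpace ℝ (Fin 2) → ℝ, ContDiff ℝ 1 φ → HasCompactSupport φ →
      ∫ ξ, ⟪gradient ψ ξ, gradient φ ξ⟫ = -∫ η, g η * φ η := by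
    rw [hψ]; exact logPotential_weak_poisson B g hg hg0 hg1
  have hI1 := integrable_norm_gradient_sq hg hg0 hg1 hneutral hψ
  have hI2 := integrable_logPotential_mul hg hg0 hg1 hψ
  have hgi : ∀ (f : EuclideanSpace ℝ (Fin 2) → ℝ) (ξ v : EuclideanSpace ℝ (Fin 2)),
      fderiv ℝ f ξ v = ⟪gradient f ξ, v⟫ := fun f ξ v => by
    rw [gradient, InnerProductSpace.toDual_symm_apply]
  -- the cut-offs `c n = χ(·/(n+1))`
  obtain ⟨χ, M, hχ, hχc, h1, h0, h01, hM⟩ := exists_bump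
  have hM0 : 0 ≤ M := (norm_nonneg _).trans (hM 0)
  have hRn : ∀ n : ℕ, (1:ℝ) ≤ (n:ℝ) + 1 := fun n => by
    have := n.cast_nonneg (α := ℝ); linarith
  obtain ⟨c, hc⟩ : ∃ c : ℕ → EuclideanSpace ℝ (Fin 2) → ℝ,
      c = fun (n : ℕ) (x : EuclideanSpace ℝ (Fin 2)) => χ ((((n:ℝ) + 1)⁻¹) • x) := ⟨_, rfl⟩
  have hcp : ∀ n : ℕ, ContDiff ℝ 1 (c n) ∧ HasCompactSupport (c n) ∧
      (∀ x, ‖x‖ < (n:ℝ) + 1 → c n x = 1) ∧ (∀ x, ‖x‖ < (n:ℝ) + 1 → fderiv ℝ (c n) x = 0) ∧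
      ∀ x, ‖fderiv ℝ (c n) x‖ ≤ 4 * M / (1 + ‖x‖) := by
    intro n
    have e : c n = fun x : EuclideanSpace ℝ (Fin 2) => χ ((((n:ℝ) + 1)⁻¹) • x) := by rw [hc]
    rw [e]
    exact scaledCutoff_props hχ hχc h1 h0 hM (hRn n)
  have hc01 : ∀ n x, 0 ≤ c n x ∧ c n x ≤ 1 := fun n x => by rw [hc]; exact h01 _
  -- eventually `‖ξ‖ < n + 1`
  have hev : ∀ ξ : EuclideanSpace ℝ (Fin 2), ∀ᶠ n : ℕ in atTop, ‖ξ‖ < (n:ℝ) + 1 := fun ξ => by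
    refine (eventually_ge_atTop ⌈‖ξ‖⌉₊).mono fun n hn => ?_
    have h1 := Nat.le_ceil ‖ξ‖
    have h2 : (⌈‖ξ‖⌉₊ : ℝ) ≤ n := Nat.cast_le.2 hn
    linarith
  -- the dominating function of the error term
  have hJ : Integrable fun x : EuclideanSpace ℝ (Fin 2) => (8 * M * Cψ * Cg) * (1 + ‖x‖) ^ (-(5 / 2 : ℝ)) :=
    (integrable_one_add_norm (by rw [finrank_euclideanSpace_fin]; norm_num)).const_mul _
  have hEbd : ∀ n ξ, ‖ψ ξ * ⟪gradient (c n) ξ, gradient ψ ξ⟫‖ ≤ (8 * M * Cψ * Cg) * (1 + ‖ξ‖) ^ (-(5 / 2 : ℝ)) := by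
    intro n ξ
    rw [norm_mul, Real.norm_eq_abs]
    have hin := abs_real_inner_le_norm (gradient (c n) ξ) (gradient ψ ξ)
    have hgn : ‖gradient (c n) ξ‖ ≤ 4 * M / (1 + ‖ξ‖) := by
      rw [gradient, LinearIsometryEquiv.norm_map]; exact (hcp n).2.2.2.2 ξ
    have hL : 0 ≤ 1 + Real.log (1 + ‖ξ‖) := by
      have := Real.log_nonneg (by linarith [norm_nonneg ξ] : (1:ℝ) ≤ 1 + ‖ξ‖); linarith
    have hw := log_weight_le_rpow ξ
    have hpos : 0 < 1 + ‖ξ‖ := by positivity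
    calc |ψ ξ| * ‖⟪gradient (c n) ξ, gradient ψ ξ⟫‖
        ≤ (Cψ * (1 + Real.log (1 + ‖ξ‖))) * ((4 * M / (1 + ‖ξ‖)) * (Cg / (1 + ‖ξ‖) ^ 2)) := by
          refine mul_le_mul (hCψ ξ) (hin.trans (mul_le_mul hgn (hCg ξ) (norm_nonneg _) (by positivity)))
            (norm_nonneg _) (by positivity)
      _ = (4 * M * Cψ * Cg) * ((1 + Real.log (1 + ‖ξ‖)) * ((1 + ‖ξ‖)⁻¹ * ((1 + ‖ξ‖) ^ 2)⁻¹)) := by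
          field_simp
      _ ≤ (4 * M * Cψ * Cg) * (2 * (1 + ‖ξ‖) ^ (-(5 / 2 : ℝ))) :=
          mul_le_mul_of_nonneg_left hw (by positivity)
      _ = _ := by ring
  have hEm : ∀ n, AEStronglyMeasurable (fun ξ => ψ ξ * ⟪gradient (c n) ξ, gradient ψ ξ⟫) volume := by
    intro n
    have hgc : Continuous (gradient (c n)) :=
      (InnerProductSpace.toDual ℝ (EuclideanSpace ℝ (Fin 2))).symm.continuous.comp
        ((hcp n).1.continuous_fderiv one_ne_zero)
    exact (hC1.continuous.mul (hgc.inner hgradc)).aestronglyMeasurable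
  have hiE : ∀ n, Integrable fun ξ => ψ ξ * ⟪gradient (c n) ξ, gradient ψ ξ⟫ := fun n =>
    hJ.mono' (hEm n) (Eventually.of_forall (hEbd n))
  have hiA : ∀ n, Integrable fun ξ => c n ξ * ‖gradient ψ ξ‖ ^ 2 := fun n =>
    hI1.mono' (((hcp n).1.continuous.mul (hgradc.norm.pow 2)).aestronglyMeasurable)
      (Eventually.of_forall fun ξ => by
        rw [norm_mul, Real.norm_eq_abs, abs_of_nonneg (hc01 n ξ).1, Real.norm_of_nonneg (sq_nonneg _)]
        exact mul_le_of_le_one_left (sq_nonneg _) (hc01 n ξ).2)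
  -- the identity for every `n`
  have hid : ∀ n : ℕ, (∫ ξ, c n ξ * ‖gradient ψ ξ‖ ^ 2) + ∫ ξ, ψ ξ * ⟪gradient (c n) ξ, gradient ψ ξ⟫ =
      -∫ ξ, g ξ * (c n ξ * ψ ξ) := by
    intro n
    have hφd : ContDiff ℝ 1 (fun x => c n x * ψ x) := (hcp n).1.mul hC1
    have hφc : HasCompactSupport (fun x => c n x * ψ x) := (hcp n).2.1.mul_right
    have hpt : ∀ ξ, ⟪gradient ψ ξ, gradient (fun x => c n x * ψ x) ξ⟫ =
        c n ξ * ‖gradient ψ ξ‖ ^ 2 + ψ ξ * ⟪gradient (c n) ξ, gradient ψ ξ⟫ := by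
      intro ξ
      rw [real_inner_comm, ← hgi, fderiv_fun_mul (((hcp n).1.differentiable one_ne_zero) ξ) (hψd ξ),
        _root_.add_apply, FunLike.coe_smul, FunLike.coe_smul, Pi.smul_apply, Pi.smul_apply, smul_eq_mul,
        smul_eq_mul, hgi ψ, hgi (c n), real_inner_self_eq_norm_sq]
    rw [← integral_add (hiA n) (hiE n), ← hweak _ hφd hφc]
    exact integral_congr_ae (Eventually.of_forall fun ξ => (hpt ξ).symm)
  -- the three limits
  have hA : Tendsto (fun n : ℕ => ∫ ξ, c n ξ * ‖gradient ψ ξ‖ ^ 2) atTop (𝓝 (∫ ξ, ‖gradient ψ ξ‖ ^ 2)) := by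
    refine tendsto_integral_of_dominated_convergence (fun ξ => ‖gradient ψ ξ‖ ^ 2)
      (fun n => ((hcp n).1.continuous.mul (hgradc.norm.pow 2)).aestronglyMeasurable) hI1
      (fun n => Eventually.of_forall fun ξ => ?_) (Eventually.of_forall fun ξ => ?_)
    · rw [norm_mul, Real.norm_eq_abs, abs_of_nonneg (hc01 n ξ).1, Real.norm_of_nonneg (sq_nonneg _)]
      exact mul_le_of_le_one_left (sq_nonneg _) (hc01 n ξ).2
    · refine tendsto_const_nhds.congr' ?_
      filter_upwards [hev ξ] with n hn
      rw [(hcp n).2.2.1 ξ hn, one_mul]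
  have hG : Tendsto (fun n : ℕ => ∫ ξ, g ξ * (c n ξ * ψ ξ)) atTop (𝓝 (∫ ξ, ψ ξ * g ξ)) := by
    refine tendsto_integral_of_dominated_convergence (fun ξ => ‖ψ ξ * g ξ‖)
      (fun n => (hg.continuous.mul ((hcp n).1.continuous.mul hC1.continuous)).aestronglyMeasurable) hI2.norm
      (fun n => Eventually.of_forall fun ξ => ?_) (Eventually.of_forall fun ξ => ?_)
    · rw [norm_mul, norm_mul, norm_mul, Real.norm_eq_abs (c n ξ), abs_of_nonneg (hc01 n ξ).1]
      calc ‖g ξ‖ * (c n ξ * ‖ψ ξ‖) ≤ ‖g ξ‖ * (1 * ‖ψ ξ‖) := by gcongr; exact (hc01 n ξ).2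
        _ = ‖ψ ξ‖ * ‖g ξ‖ := by ring
    · refine tendsto_const_nhds.congr' ?_
      filter_upwards [hev ξ] with n hn
      rw [(hcp n).2.2.1 ξ hn, one_mul, mul_comm]
  have hE : Tendsto (fun n : ℕ => ∫ ξ, ψ ξ * ⟪gradient (c n) ξ, gradient ψ ξ⟫) atTop (𝓝 0) := by
    have h := tendsto_integral_of_dominated_convergence (fun ξ => (8 * M * Cψ * Cg) * (1 + ‖ξ‖) ^ (-(5 / 2 : ℝ)))
      hEm hJ (fun n => Eventually.of_forall (hEbd n))
      (Eventually.of_forall fun ξ => (?_ :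
        Tendsto (fun n : ℕ => ψ ξ * ⟪gradient (c n) ξ, gradient ψ ξ⟫) atTop (𝓝 0)))
    · simpa using h
    · refine tendsto_const_nhds.congr' ?_
      filter_upwards [hev ξ] with n hn
      rw [gradient, (hcp n).2.2.2.1 ξ hn, map_zero, inner_zero_left, mul_zero]
  have hlim1 := hA.add hE
  have hlim2 : Tendsto (fun n : ℕ => (∫ ξ, c n ξ * ‖gradient ψ ξ‖ ^ 2) +
      ∫ ξ, ψ ξ * ⟪gradient (c n) ξ, gradient ψ ξ⟫) atTop (𝓝 (-(∫ ξ, ψ ξ * g ξ))) := by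
    simp_rw [hid]
    exact hG.neg
  have := tendsto_nhds_unique hlim1 hlim2
  rwa [add_zero] at this

end Energy

/-! ### The registered helper -/

/-- **Energy identity for the logarithmic potential of a NEUTRAL density**: for `ψ = N ∗ g`, `N = (2π)⁻¹ log ‖·‖`,
`g ∈ C¹` with `|g|, ‖Dg‖ ≤ B e^{−‖η‖²/8}` and `∫ g = 0`: `‖∇ψ‖² ∈ L¹`, `ψ g ∈ L¹` and `∫ ‖∇ψ‖² = −∫ ψ g`
(registered helper toward `logPotential_neutral_energy` / `stub_coreInverse`). [folklore] -/
theorem logPotential_energy_identity :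
    ∀ (B : ℝ) (g : EuclideanSpace ℝ (Fin 2) → ℝ), ContDiff ℝ 1 g →
      (∀ η, |g η| ≤ B * Real.exp (-(1 / 8) * ‖η‖ ^ 2)) →
      (∀ η, ‖fderiv ℝ g η‖ ≤ B * Real.exp (-(1 / 8) * ‖η‖ ^ 2)) → (∫ η, g η = 0) →
      ∀ ψ : EuclideanSpace ℝ (Fin 2) → ℝ,
        ψ = (fun ξ : EuclideanSpace ℝ (Fin 2) => ∫ η, (2 * Real.pi)⁻¹ * Real.log ‖ξ - η‖ * g η) →
        Integrable (fun ξ => ‖gradient ψ ξ‖ ^ 2) ∧ Integrable (fun ξ => ψ ξ * g ξ) ∧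
          ∫ ξ, ‖gradient ψ ξ‖ ^ 2 = -∫ ξ, ψ ξ * g ξ :=
  fun _ _ hg hg0 hg1 hneutral _ hψ =>
    ⟨integrable_norm_gradient_sq hg hg0 hg1 hneutral hψ, integrable_logPotential_mul hg hg0 hg1 hψ,
      integral_norm_gradient_sq_eq hg hg0 hg1 hneutral hψ⟩

end Summit.AnomalousDissipation.AnomalousDissipation.Theorems.MarginalStabilityChainStretchedVortexRows

end
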